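import Summits.QuantumAdvantage.QuantumAdvantage.Theorems.SosSandwichCornerLiftA
import Literature.Computability.Complexity.GabberGalil

/-!
# SosSandwichCornerLift — part B (2/4): granularity, the coin-free amplifier, its analysis

Tree twin of `decomp-qadv/lens-5/g20/CornerLift.lean` §6–§8. Granularity lemma `exists_pow_window`
(an exponent `m` with `g^m ∈ (τ g₀, τ]`, `m ≤ 1 + 1/(τ(1-ḡ))`); the amplifier
`ampPoly s m D k p = 1 - ∏_{β<s} (1 - ∏_{γ<m} rename (emb β γ) (detPoly D k p))` on `Fin (s·m·N)` — the
detector `detPoly D k p = cdf D k ∘ p` in `K_{D T}`, AND over `m` fresh copies, OR over `s` fresh blocks, NO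
fresh coins — lies in `K_{s m D T}`; exact mean `1 - (1 - g^m)^s` by Fubini; near-Booleanness
`E t(P) ≤ s m · E t(cdf ∘ p)`; every variable of `P` is a copy `(β,γ,i)` of a variable `i` of `p` with
`Inf_{(β,γ,i)} P ≤ D² · Inf_i p`.
-/

set_option linter.dupNamespace false
set_option autoImplicit false

noncomputable section

open Finset
open Literature.Computability.QuantumComplexity
open Summit.QuantumAdvantage.QuantumAdvantage.Theorems.SosSandwich

namespace Summit.QuantumAdvantage.QuantumAdvantage.Theorems.SosSandwich.CornerLift

variable {N : ℕ}

/-! ## §6 Granularity: choosing the AND-width `m` and the OR-width `s` -/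

section Granularity

/-- **Power window**: for a base `g ∈ [g₀, ḡ] ⊂ (0,1)` and a target `τ ∈ (0,1)` there is an exponent `m ≥ 1`
with `g^m ≤ τ < g^m / g₀⁻¹…`, precisely `τ g₀ < g^m ≤ τ`, and `m ≤ 1 + 1/(τ (1 - ḡ))`. [folklore] -/
theorem exists_pow_window {g g₀ gbar τ : ℝ} (hg₀ : 0 < g₀) (hg₀g : g₀ ≤ g) (hgg : g ≤ gbar)
    (hgbar : gbar < 1) (hτ0 : 0 < τ) (hτ1 : τ < 1) :
    ∃ m : ℕ, 1 ≤ m ∧ g ^ m ≤ τ ∧ τ * g₀ < g ^ m ∧ (m : ℝ) ≤ 1 + 1 / (τ * (1 - gbar)) := by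
  classical
  have hg : 0 < g := hg₀.trans_le hg₀g
  have hex : ∃ m : ℕ, g ^ m ≤ τ := by
    obtain ⟨n, hn⟩ := exists_pow_lt_of_lt_one hτ0 (hgg.trans_lt hgbar)
    exact ⟨n, hn.le⟩
  refine ⟨Nat.find hex, ?_, Nat.find_spec hex, ?_, ?_⟩
  · by_contra h
    have h0 : Nat.find hex = 0 := by omega
    have := Nat.find_spec hex
    rw [h0, pow_zero] at this
    linarith
  · have hm0 : Nat.find hex ≠ 0 := by
      intro h0
      have := Nat.find_spec hex
      rw [h0, pow_zero] at this
      linarith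
    obtain ⟨m', hm'⟩ := Nat.exists_eq_succ_of_ne_zero hm0
    have hprev : ¬ g ^ m' ≤ τ := Nat.find_min hex (by omega)
    push Not at hprev
    rw [hm', pow_succ]
    calc τ * g₀ ≤ τ * g := mul_le_mul_of_nonneg_left hg₀g hτ0.le
      _ < g ^ m' * g := mul_lt_mul_of_pos_right hprev hg
  · have hm0 : Nat.find hex ≠ 0 := by
      intro h0
      have := Nat.find_spec hex
      rw [h0, pow_zero] at this
      linarith
    obtain ⟨m', hm'⟩ := Nat.exists_eq_succ_of_ne_zero hm0
    have hprev : ¬ g ^ m' ≤ τ := Nat.find_min hex (by omega)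
    push Not at hprev
    have h1 : g ^ m' ≤ gbar ^ m' := pow_le_pow_left₀ hg.le hgg _
    have h2 : gbar ^ m' ≤ 1 / (1 + m' * (1 - gbar)) := by
      have := Literature.Computability.Complexity.GabberGalil.one_sub_pow_le (x := 1 - gbar) (by linarith) (by linarith) m'
      simpa using this
    have h3 : τ < 1 / (1 + m' * (1 - gbar)) := hprev.trans_le (h1.trans h2)
    have hpos : 0 < 1 + (m' : ℝ) * (1 - gbar) := by
      have : (0 : ℝ) ≤ m' := Nat.cast_nonneg _
      nlinarith
    rw [lt_div_iff₀ hpos] at h3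
    have h4 : (m' : ℝ) * (τ * (1 - gbar)) < 1 := by nlinarith
    have h5 : (m' : ℝ) < 1 / (τ * (1 - gbar)) := by
      rw [lt_div_iff₀ (mul_pos hτ0 (by linarith))]; exact h4
    rw [hm']; push_cast; linarith

end Granularity

/-! ## §7 The amplifier: detector ∘ `p`, AND over `m` fresh copies, OR over `s` fresh blocks -/

section Amplify

open MvPolynomial

variable {N : ℕ}

/-- The flattening `(Fin s × Fin m) × Fin N ≃ Fin (s * m * N)` of the copy-structured variable set. -/
def flat (s m N : ℕ) : (Fin s × Fin m) × Fin N ≃ Fin (s * m * N) :=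
  (Equiv.prodCongr finProdFinEquiv (Equiv.refl (Fin N))).trans finProdFinEquiv

/-- Variable `i` of copy `c`. -/
def emb (s m N : ℕ) (c : Fin s × Fin m) (i : Fin N) : Fin (s * m * N) := flat s m N (c, i)

/-- Structured view of a point of the big cube: `view y β γ` is the input seen by copy `(β, γ)`. -/
def view (s m N : ℕ) (y : Fin (s * m * N) → Bool) : Fin s → Fin m → (Fin N → Bool) :=
  fun β γ i => y (emb s m N (β, γ) i)

/-- `view` is a bijection. -/
def viewEquiv (s m N : ℕ) : (Fin (s * m * N) → Bool) ≃ (Fin s → Fin m → (Fin N → Bool)) where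
  toFun := view s m N
  invFun X j := X ((flat s m N).symm j).1.1 ((flat s m N).symm j).1.2 ((flat s m N).symm j).2
  left_inv y := by
    funext j
    simp only [view, emb, Prod.mk.eta, Equiv.apply_symm_apply]
  right_inv X := by
    funext β γ i
    simp only [view, emb, Equiv.symm_apply_apply]

/-- The detector as a polynomial in `p`: `Σ_{ν ≤ D} [ν ≤ k] C(D,ν) p^ν (1-p)^{D-ν}`. -/
def detPoly (D k : ℕ) (p : MvPolynomial (Fin N) ℝ) : MvPolynomial (Fin N) ℝ :=
  ∑ ν ∈ Finset.range (D + 1), C ((if ν ≤ k then (1 : ℝ) else 0) * (D.choose ν : ℝ)) * p ^ ν * (1 - p) ^ (D - ν)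

/-- The detector `detPoly D k p` lies in `K_{D·T}` (Bernstein closure of `K`). [folklore] -/
theorem detPoly_pseudoBounded {T : ℕ} {p : MvPolynomial (Fin N) ℝ} (hp : PseudoBounded T p) (D k : ℕ) :
    PseudoBounded (D * T) (detPoly D k p) :=
  PseudoBounded.bernstein hp D (fun ν => if ν ≤ k then 1 else 0)
    (fun ν => by split_ifs <;> norm_num) (fun ν => by split_ifs <;> norm_num)

/-- On the cube the detector evaluates to `cdf D k (p x)`. [folklore] -/
theorem evalBool_detPoly (D k : ℕ) (p : MvPolynomial (Fin N) ℝ) (x : Fin N → Bool) :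
    evalBool (detPoly D k p) x = cdf D k (evalBool p x) := by
  rw [cdf_eq_indicator_sum]
  unfold detPoly evalBool
  rw [map_sum]
  refine Finset.sum_congr rfl fun ν _ => ?_
  simp only [map_mul, map_pow, eval_C, map_sub, map_one, bterm]
  ring

/-- **The amplified polynomial** `P = 1 - ∏_β (1 - ∏_γ B(copy (β,γ)))` on `s·m·N` variables. -/
def ampPoly (s m D k : ℕ) (p : MvPolynomial (Fin N) ℝ) : MvPolynomial (Fin (s * m * N)) ℝ :=
  1 - ∏ β : Fin s, (1 - ∏ γ : Fin m, rename (emb s m N (β, γ)) (detPoly D k p))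

/-- The amplifier lies in `K_{s·m·D·T}` (product / complement / rename closure of `K`). [folklore] -/
theorem ampPoly_pseudoBounded {T : ℕ} {p : MvPolynomial (Fin N) ℝ} (hp : PseudoBounded T p)
    (s m D k : ℕ) : PseudoBounded (s * (m * (D * T))) (ampPoly s m D k p) := by
  have inner : ∀ β : Fin s, PseudoBounded (m * (D * T))
      (∏ γ : Fin m, rename (emb s m N (β, γ)) (detPoly D k p)) := by
    intro β
    have h := PseudoBounded.prod (Finset.univ : Finset (Fin m))
      (fun γ => rename (emb s m N (β, γ)) (detPoly D k p)) (fun _ => D * T)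
      fun γ _ => PseudoBounded.rename _ (detPoly_pseudoBounded hp D k)
    simpa [Finset.sum_const, Finset.card_univ, Fintype.card_fin, smul_eq_mul] using h
  have h := PseudoBounded.orFamily (Finset.univ : Finset (Fin s))
    (fun β => ∏ γ : Fin m, rename (emb s m N (β, γ)) (detPoly D k p)) (fun _ => m * (D * T))
    fun β _ => inner β
  simpa [ampPoly, Finset.sum_const, Finset.card_univ, Fintype.card_fin, smul_eq_mul] using h

/-- The structured cube function of the amplifier. -/
def ampFun (s m D k : ℕ) (r : (Fin N → Bool) → ℝ) (X : Fin s → Fin m → (Fin N → Bool)) : ℝ :=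
  1 - ∏ β : Fin s, (1 - ∏ γ : Fin m, cdf D k (r (X β γ)))

/-- On the cube the amplifier evaluates to `ampFun` of the copy views. [folklore] -/
theorem evalBool_ampPoly (s m D k : ℕ) (p : MvPolynomial (Fin N) ℝ) (y : Fin (s * m * N) → Bool) :
    evalBool (ampPoly s m D k p) y = ampFun s m D k (evalBool p) (view s m N y) := by
  unfold ampPoly ampFun evalBool
  simp only [map_sub, map_one, map_prod, eval_rename]
  congr 1
  refine Finset.prod_congr rfl fun β _ => ?_
  congr 1
  refine Finset.prod_congr rfl fun γ _ => ?_
  have : ((fun k : Fin (s * m * N) => if y k then (1 : ℝ) else 0) ∘ emb s m N (β, γ)) =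
      fun i : Fin N => if view s m N y β γ i then (1 : ℝ) else 0 := by
    funext i; rfl
  rw [this]
  exact evalBool_detPoly D k p (view s m N y β γ)

end Amplify

/-! ## §8 Analysis of the amplifier: exact mean, near-Booleanness, influence domination -/

section Analysis

open MvPolynomial

variable {N : ℕ}

/-- **Exact mean by independence**: `E P = 1 - (1 - g^m)^s`, `g = E[B ∘ p]`. [folklore] -/
theorem boolAvg_ampPoly (s m D k : ℕ) (p : MvPolynomial (Fin N) ℝ) :
    boolAvg (evalBool (ampPoly s m D k p)) =
      1 - (1 - (boolAvg (fun z => cdf D k (evalBool p z))) ^ m) ^ s := by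
  have h1 : boolAvg (evalBool (ampPoly s m D k p)) =
      uavg (fun X : Fin s → Fin m → (Fin N → Bool) => ampFun s m D k (evalBool p) X) := by
    rw [boolAvg_eq_uavg]
    have : evalBool (ampPoly s m D k p) =
        fun y => ampFun s m D k (evalBool p) (viewEquiv s m N y) := by
      funext y; exact evalBool_ampPoly s m D k p y
    rw [this]
    exact uavg_comp_equiv (viewEquiv s m N) (fun X => ampFun s m D k (evalBool p) X)
  have h2 : uavg (fun X : Fin s → Fin m → (Fin N → Bool) =>
      ∏ β, (1 - ∏ γ, cdf D k (evalBool p (X β γ)))) =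
      ∏ _β : Fin s, uavg (fun Z : Fin m → (Fin N → Bool) => 1 - ∏ γ, cdf D k (evalBool p (Z γ))) :=
    uavg_pi_prod (fun (_ : Fin s) (Z : Fin m → (Fin N → Bool)) => 1 - ∏ γ, cdf D k (evalBool p (Z γ)))
  have h3 : uavg (fun Z : Fin m → (Fin N → Bool) => ∏ γ, cdf D k (evalBool p (Z γ))) =
      ∏ _γ : Fin m, uavg (fun z : Fin N → Bool => cdf D k (evalBool p z)) :=
    uavg_pi_prod (fun (_ : Fin m) (z : Fin N → Bool) => cdf D k (evalBool p z))
  have h4 : uavg (fun Z : Fin m → (Fin N → Bool) => 1 - ∏ γ, cdf D k (evalBool p (Z γ))) =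
      1 - (boolAvg (fun z => cdf D k (evalBool p z))) ^ m := by
    have := uavg_sub (fun _ : Fin m → (Fin N → Bool) => (1 : ℝ))
      (fun Z => ∏ γ, cdf D k (evalBool p (Z γ)))
    rw [uavg_const, h3, Finset.prod_const, Finset.card_univ, Fintype.card_fin, ← boolAvg_eq_uavg] at this
    exact this
  rw [h1]
  unfold ampFun
  rw [uavg_sub (fun _ => (1 : ℝ)) (fun X : Fin s → Fin m → (Fin N → Bool) =>
      ∏ β, (1 - ∏ γ, cdf D k (evalBool p (X β γ)))), uavg_const, h2, h4, Finset.prod_const,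
    Finset.card_univ, Fintype.card_fin]

/-- Pointwise near-Booleanness of the amplifier: `t(P) ≤ Σ_{β,γ} t(B(copy))`. [folklore] -/
theorem tcorner_ampFun_le (s m D k : ℕ) {r : (Fin N → Bool) → ℝ} (hr0 : ∀ z, 0 ≤ r z)
    (hr1 : ∀ z, r z ≤ 1) (X : Fin s → Fin m → (Fin N → Bool)) :
    tcorner (ampFun s m D k r X) ≤ ∑ β, ∑ γ, tcorner (cdf D k (r (X β γ))) := by
  unfold ampFun
  rw [tcorner_one_sub]
  have hF : ∀ β : Fin s, 0 ≤ ∏ γ, cdf D k (r (X β γ)) ∧ ∏ γ, cdf D k (r (X β γ)) ≤ 1 := fun β =>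
    prod_mem_unitInterval Finset.univ (fun γ _ => cdf_nonneg D k (hr0 _) (hr1 _))
      (fun γ _ => cdf_le_one D k (hr0 _) (hr1 _))
  refine (tcorner_prod_le Finset.univ (fun β _ => sub_nonneg.mpr (hF β).2)
    (fun β _ => sub_le_self _ (hF β).1)).trans (Finset.sum_le_sum fun β _ => ?_)
  rw [tcorner_one_sub]
  exact tcorner_prod_le Finset.univ (fun γ _ => cdf_nonneg D k (hr0 _) (hr1 _))
    (fun γ _ => cdf_le_one D k (hr0 _) (hr1 _))

/-- **Near-Booleanness budget**: `E[t(P)] ≤ s m · E[t(B ∘ p)]`. [folklore] -/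
theorem boolAvg_tcorner_ampPoly_le {T : ℕ} {p : MvPolynomial (Fin N) ℝ} (hp : PseudoBounded T p)
    (s m D k : ℕ) :
    boolAvg (fun y => tcorner (evalBool (ampPoly s m D k p) y)) ≤
      (s * m : ℝ) * boolAvg (fun z => tcorner (cdf D k (evalBool p z))) := by
  set φ : (Fin N → Bool) → ℝ := fun z => tcorner (cdf D k (evalBool p z)) with hφ
  have h1 : boolAvg (fun y => tcorner (evalBool (ampPoly s m D k p) y)) =
      uavg (fun X : Fin s → Fin m → (Fin N → Bool) => tcorner (ampFun s m D k (evalBool p) X)) := by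
    rw [boolAvg_eq_uavg]
    have : (fun y => tcorner (evalBool (ampPoly s m D k p) y)) =
        fun y => tcorner (ampFun s m D k (evalBool p) (viewEquiv s m N y)) := by
      funext y; rw [evalBool_ampPoly]; rfl
    rw [this]
    exact uavg_comp_equiv (viewEquiv s m N) (fun X => tcorner (ampFun s m D k (evalBool p) X))
  have h2 : uavg (fun X : Fin s → Fin m → (Fin N → Bool) => tcorner (ampFun s m D k (evalBool p) X)) ≤
      uavg (fun X : Fin s → Fin m → (Fin N → Bool) => ∑ β, ∑ γ, φ (X β γ)) :=
    uavg_mono fun X => tcorner_ampFun_le s m D k hp.eval_nonneg hp.eval_le_one X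
  have h3 : uavg (fun X : Fin s → Fin m → (Fin N → Bool) => ∑ β, ∑ γ, φ (X β γ)) =
      ∑ β : Fin s, ∑ γ : Fin m, uavg (fun X : Fin s → Fin m → (Fin N → Bool) => φ (X β γ)) := by
    rw [uavg_sum]
    exact Finset.sum_congr rfl fun β _ => uavg_sum _ _
  have h4 : ∀ (β : Fin s) (γ : Fin m),
      uavg (fun X : Fin s → Fin m → (Fin N → Bool) => φ (X β γ)) = boolAvg φ := by
    intro β γ
    rw [boolAvg_eq_uavg]
    have e1 := uavg_coord (Ω := Fin m → (Fin N → Bool)) (C := Fin s) β (fun Z => φ (Z γ))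
    have e2 := uavg_coord (Ω := Fin N → Bool) (C := Fin m) γ φ
    exact e1.trans e2
  rw [h1]
  refine h2.trans ?_
  rw [h3]
  simp only [h4, Finset.sum_const, Finset.card_univ, Fintype.card_fin]
  ring_nf
  rfl

/-- The structured view of a bit flip: only copy `c₀` changes, by the flip of its bit `i₀`. [folklore] -/
theorem view_flipBit (s m N : ℕ) (y : Fin (s * m * N) → Bool) (c₀ : Fin s × Fin m) (i₀ : Fin N) :
    view s m N (flipBit (emb s m N c₀ i₀) y) =
      fun β γ => if (β, γ) = c₀ then flipBit i₀ (view s m N y β γ) else view s m N y β γ := by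
  funext β γ i
  by_cases hc : (β, γ) = c₀
  · rw [if_pos hc]
    by_cases hi : i = i₀
    · subst hi; subst hc
      simp [view, flipBit, emb]
    · subst hc
      have hne : emb s m N (β, γ) i ≠ emb s m N (β, γ) i₀ := by
        intro h; exact hi (by simpa [emb] using h)
      simp [view, flipBit, emb, hi]
  · rw [if_neg hc]
    have hne : emb s m N (β, γ) i ≠ emb s m N c₀ i₀ := by
      intro h
      have := (flat s m N).injective h
      simp only [Prod.mk.injEq] at this
      exact hc this.1
    simp [view, flipBit, hne]

/-- Pointwise one-variable Lipschitz bound of the amplifier. [folklore] -/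
theorem abs_ampFun_sub_le (s m D k : ℕ) {r : (Fin N → Bool) → ℝ} (hr0 : ∀ z, 0 ≤ r z)
    (hr1 : ∀ z, r z ≤ 1) (X : Fin s → Fin m → (Fin N → Bool)) (c₀ : Fin s × Fin m) (i₀ : Fin N) :
    |ampFun s m D k r X -
        ampFun s m D k r (fun β γ => if (β, γ) = c₀ then flipBit i₀ (X β γ) else X β γ)| ≤
      (D : ℝ) * |r (X c₀.1 c₀.2) - r (flipBit i₀ (X c₀.1 c₀.2))| := by
  classical
  set X' : Fin s → Fin m → (Fin N → Bool) :=
    fun β γ => if (β, γ) = c₀ then flipBit i₀ (X β γ) else X β γ with hX'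
  have hc0 : ∀ z, 0 ≤ cdf D k (r z) := fun z => cdf_nonneg D k (hr0 z) (hr1 z)
  have hc1 : ∀ z, cdf D k (r z) ≤ 1 := fun z => cdf_le_one D k (hr0 z) (hr1 z)
  have hF : ∀ (Y : Fin s → Fin m → (Fin N → Bool)) (β : Fin s),
      0 ≤ ∏ γ, cdf D k (r (Y β γ)) ∧ ∏ γ, cdf D k (r (Y β γ)) ≤ 1 := fun Y β =>
    prod_mem_unitInterval Finset.univ (fun γ _ => hc0 _) (fun γ _ => hc1 _)
  unfold ampFun
  rw [show ∀ a b : ℝ, (1 - a) - (1 - b) = -(a - b) from fun a b => by ring, abs_neg]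
  -- outer product: only block `c₀.1` differs
  have step1 := abs_prod_sub_prod_le (Finset.univ : Finset (Fin s))
    (u := fun β => 1 - ∏ γ, cdf D k (r (X β γ))) (v := fun β => 1 - ∏ γ, cdf D k (r (X' β γ))) c₀.1
    (fun β _ => sub_nonneg.mpr (hF X' β).2) (fun β _ => sub_le_self _ (hF X' β).1)
    (fun β _ hβ => by
      have : ∀ γ, X' β γ = X β γ := fun γ => by
        simp only [hX']; rw [if_neg]; intro h; exact hβ (by rw [← h])
      simp only [this])
  refine step1.trans ?_
  rw [show ∀ a b : ℝ, (1 - a) - (1 - b) = -(a - b) from fun a b => by ring, abs_neg]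
  -- inner product: only copy `c₀.2` of block `c₀.1` differs
  have step2 := abs_prod_sub_prod_le (Finset.univ : Finset (Fin m))
    (u := fun γ => cdf D k (r (X c₀.1 γ))) (v := fun γ => cdf D k (r (X' c₀.1 γ))) c₀.2
    (fun γ _ => hc0 _) (fun γ _ => hc1 _)
    (fun γ _ hγ => by
      have : X' c₀.1 γ = X c₀.1 γ := by
        simp only [hX']; rw [if_neg]; intro h; exact hγ (by rw [← h])
      simp only [this])
  refine step2.trans ?_
  have hX'c : X' c₀.1 c₀.2 = flipBit i₀ (X c₀.1 c₀.2) := by simp [hX']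
  simp only [hX'c]
  exact cdf_lipschitz D k (hr0 _) (hr1 _) (hr0 _) (hr1 _)

/-- **Influence domination**: every variable of `P` is a copy of a variable of `p`, with
`Inf_j P ≤ D² · Inf_i p`. [folklore] -/
theorem influence_ampPoly_le {T : ℕ} {p : MvPolynomial (Fin N) ℝ} (hp : PseudoBounded T p)
    (s m D k : ℕ) (j : Fin (s * m * N)) :
    ∃ i : Fin N, influence j (ampPoly s m D k p) ≤ (D : ℝ) ^ 2 * influence i p := by
  classical
  set c₀ : Fin s × Fin m := ((flat s m N).symm j).1 with hc₀
  set i₀ : Fin N := ((flat s m N).symm j).2 with hi₀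
  have hj : j = emb s m N c₀ i₀ := by
    rw [emb, hc₀, hi₀, Prod.mk.eta, Equiv.apply_symm_apply]
  refine ⟨i₀, ?_⟩
  set φ : (Fin N → Bool) → ℝ := fun z => (evalBool p z - evalBool p (flipBit i₀ z)) ^ 2 with hφ
  -- pointwise bound
  have pt : ∀ y : Fin (s * m * N) → Bool,
      (evalBool (ampPoly s m D k p) y - evalBool (ampPoly s m D k p) (flipBit j y)) ^ 2 ≤
        (D : ℝ) ^ 2 * φ (view s m N y c₀.1 c₀.2) := by
    intro y
    rw [evalBool_ampPoly, evalBool_ampPoly, hj, view_flipBit]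
    have h := abs_ampFun_sub_le s m D k hp.eval_nonneg hp.eval_le_one (view s m N y) c₀ i₀
    have h2 := pow_le_pow_left₀ (abs_nonneg _) h 2
    rw [sq_abs, mul_pow, sq_abs] at h2
    exact h2
  have h1 : influence j (ampPoly s m D k p) ≤
      boolAvg (fun y => (D : ℝ) ^ 2 * φ (view s m N y c₀.1 c₀.2)) := by
    unfold influence
    rw [boolAvg_eq_uavg, boolAvg_eq_uavg]
    exact uavg_mono pt
  refine h1.trans (le_of_eq ?_)
  rw [boolAvg_eq_uavg, uavg_const_mul]
  congr 1
  have e0 : uavg (fun y : Fin (s * m * N) → Bool => φ (view s m N y c₀.1 c₀.2)) =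
      uavg (fun X : Fin s → Fin m → (Fin N → Bool) => φ (X c₀.1 c₀.2)) :=
    uavg_comp_equiv (viewEquiv s m N) (fun X : Fin s → Fin m → (Fin N → Bool) => φ (X c₀.1 c₀.2))
  have e1 := uavg_coord (Ω := Fin m → (Fin N → Bool)) (C := Fin s) c₀.1 (fun Z => φ (Z c₀.2))
  have e2 := uavg_coord (Ω := Fin N → Bool) (C := Fin m) c₀.2 φ
  rw [e0, e1, e2, influence, boolAvg_eq_uavg]

end Analysis

end Summit.QuantumAdvantage.QuantumAdvantage.Theorems.SosSandwich.CornerLift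

end
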